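import Literature.MathematicalPhysics.QuantumLattice.HeisenbergOrder
import Literature.MathematicalPhysics.QuantumLattice.ProductOperators
import Literature.MathematicalPhysics.QuantumLattice.SpinOperatorsProofs
import HarnessLib

/-!
# Heisenberg order: discharges (`|m_L(β, h)| ≤ S`, `⟨𝐒_x · 𝐒_y⟩` as a Gibbs expectation)

Sibling proof file of `HeisenbergOrder.lean` (item
`provefact-Literature.MathematicalPhysics.QuantumLattice.abs_torusMagnetisation_le`). No statement is
introduced or changed; this file discharges the named facts

* `abs_torusMagnetisation_le_holds : abs_torusMagnetisation_le` — `|m_L(β, h)| ≤ n/2 = S` for the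
  magnetisation per site `m_L(β, h) = |Λ|⁻¹ Σ_x ⟨S³_x⟩_{β,L,h}` (Mermin–Wagner 1966, eq. (2), the
  quantity `s_z`) of the spin-`S` Heisenberg model in a field on the torus `(ℤ/Lℤ)^d`.
* `spinSpinCorrTorus_eq_gibbsState_spinDot_holds : spinSpinCorrTorus_eq_gibbsState_spinDot` — for
  `L ≠ 0`, `spinSpinCorrTorus β L n J x y = re ⟨𝐒_x · 𝐒_y⟩_{β,L}`: the thermal correlation
  `re Σ_α tr(e^{-βH_L} S^α_x S^α_y)/Z` (`Matrix.thermalCorr`) is the Gibbs expectation of the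
  (symmetrised) exchange operator `spinDot n x y = Σ_α ½ (S^α_x S^α_y + S^α_y S^α_x)`
  (Tasaki (2020) §2.4, eq. (2.4.1)). Proof (last section of this file): the Gibbs state is
  `ℂ`-linear; `H_L` and the spins are Hermitian, so `⟨S^α_y S^α_x⟩ = ⟨(S^α_x S^α_y)ᴴ⟩ =
  conj ⟨S^α_x S^α_y⟩` (`Matrix.gibbsState_conjTranspose`) and `re ½ (z + conj z) = re z`,
  uniformly in `x = y` / `x ≠ y` (no appeal to `siteSpin_commute_of_ne`).

The argument for the magnetisation bound is the textbook one: the spectrum of a spin component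
is `{-S, …, S}`, i.e. the Loewner bounds `S·1 ± S³_x ≥ 0` (Tasaki (2020) §2.1, eq. (2.1.3);
`posSemidef_smul_one_sub_spinVec`, `posSemidef_smul_one_add_spinVec` of `SpinOperatorsProofs`,
transported to the many-body space by the positive map `onSite`, `onSite_posSemidef`); summing
over the `|Λ| = L^d` sites gives `|Λ| S·1 ± S³_tot ≥ 0`, and the Gibbs state `A ↦ tr(e^{-βH} A)/Z`
of the (Hermitian) Hamiltonian in a field is a positive normalised functional
(`Matrix.gibbsState_nonneg_of_posSemidef`, `Matrix.gibbsState_one`), whence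
`-S ≤ Re ⟨|Λ|⁻¹ S³_tot⟩ ≤ S`.

Sources: N. D. Mermin, H. Wagner, Phys. Rev. Lett. 17 (1966) 1133, eq. (2) (definition of the
magnetisation per site); H. Tasaki, *Physics and Mathematics of Quantum Many-Body Systems* (2020),
§2.1, eq. (2.1.3) (`spec S^α = {-S, …, S}`) and App. A (Gibbs states are states).
-/

noncomputable section

open Finset Matrix Complex
open scoped ComplexOrder MatrixOrder
open Literature.MathematicalPhysics.QuantumLattice Literature.Probability.LatticeModels

namespace Literature.MathematicalPhysics.QuantumLattice

section TotalSpinBounds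

variable {Λ : Type*} [Fintype Λ] [DecidableEq Λ]

/-- `|Λ| S·1 - Sᵅ_tot ≥ 0` on the many-body space: the sum over `x` of `S·1 - Sᵅ_x ≥ 0`.
Tasaki (2020) §2.2, eq. (2.2.11) with §2.1, eq. (2.1.3). [folklore] -/
theorem posSemidef_card_smul_one_sub_totalSpin (n : ℕ) (α : Fin 3) :
    Matrix.PosSemidef
      (((Fintype.card Λ : ℂ) * ((n : ℂ) / 2)) • (1 : Op Λ (n + 1)) - totalSpin n α) := by
  have h : ((Fintype.card Λ : ℂ) * ((n : ℂ) / 2)) • (1 : Op Λ (n + 1)) - totalSpin n α =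
      ∑ x : Λ, (((n : ℂ) / 2) • (1 : Op Λ (n + 1)) - siteSpin n x α) := by
    rw [Finset.sum_sub_distrib, Finset.sum_const, Finset.card_univ, ← nsmul_eq_mul, smul_assoc,
      totalSpin]
  rw [h]
  refine Finset.sum_induction _ Matrix.PosSemidef (fun a b ha hb => ha.add hb)
    Matrix.PosSemidef.zero fun x _ => ?_
  have hx : ((n : ℂ) / 2) • (1 : Op Λ (n + 1)) - siteSpin n x α =
      onSite x (((n : ℂ) / 2) • 1 - spinVec n α) := by
    rw [onSite_sub', onSite_smul', onSite_one']
    rfl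
  rw [hx]
  exact onSite_posSemidef x (posSemidef_smul_one_sub_spinVec n α)

/-- `|Λ| S·1 + Sᵅ_tot ≥ 0` on the many-body space: the sum over `x` of `S·1 + Sᵅ_x ≥ 0`.
Tasaki (2020) §2.2, eq. (2.2.11) with §2.1, eq. (2.1.3). [folklore] -/
theorem posSemidef_card_smul_one_add_totalSpin (n : ℕ) (α : Fin 3) :
    Matrix.PosSemidef
      (((Fintype.card Λ : ℂ) * ((n : ℂ) / 2)) • (1 : Op Λ (n + 1)) + totalSpin n α) := by
  have h : ((Fintype.card Λ : ℂ) * ((n : ℂ) / 2)) • (1 : Op Λ (n + 1)) + totalSpin n α =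
      ∑ x : Λ, (((n : ℂ) / 2) • (1 : Op Λ (n + 1)) + siteSpin n x α) := by
    rw [Finset.sum_add_distrib, Finset.sum_const, Finset.card_univ, ← nsmul_eq_mul, smul_assoc,
      totalSpin]
  rw [h]
  refine Finset.sum_induction _ Matrix.PosSemidef (fun a b ha hb => ha.add hb)
    Matrix.PosSemidef.zero fun x _ => ?_
  have hx : ((n : ℂ) / 2) • (1 : Op Λ (n + 1)) + siteSpin n x α =
      onSite x (((n : ℂ) / 2) • 1 + spinVec n α) := by
    rw [onSite_add', onSite_smul', onSite_one']
    rfl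
  rw [hx]
  exact onSite_posSemidef x (posSemidef_smul_one_add_spinVec n α)

end TotalSpinBounds

/-! ### Discharge of `abs_torusMagnetisation_le` -/

/-- **Discharge of `abs_torusMagnetisation_le`**: `|m_L(β, h)| ≤ n/2 = S` for every `β`, `d`, `L`,
`n`, `J`, `h`. For `L = 0` this is the junk value `0`; for `L ≠ 0`, `|Λ| = L^d` and
`S·1 ∓ |Λ|⁻¹ S³_tot = |Λ|⁻¹ (|Λ| S·1 ∓ S³_tot) ≥ 0`, and the Gibbs state of the Hermitian
Hamiltonian `H_{L,h}` is positive with `⟨1⟩ = 1`, so `∓ Re ⟨|Λ|⁻¹ S³_tot⟩ + S ≥ 0`.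
Mermin–Wagner, PRL 17 (1966) 1133, eq. (2) (the magnetisation per site `s_z`, trivially bounded by
the spin `S`); Tasaki (2020) §2.1, eq. (2.1.3). [cite: MerminWagner1966, eq. (2)] -/
theorem abs_torusMagnetisation_le_holds : abs_torusMagnetisation_le := by
  intro β d L n J h
  rcases Nat.eq_zero_or_pos L with rfl | hL
  · have h0 : torusMagnetisation β d 0 n J h = 0 := by simp [torusMagnetisation]
    rw [h0, abs_zero]
    positivity
  haveI : NeZero L := ⟨hL.ne'⟩
  rw [torusMagnetisation_of_neZero]
  set H := heisenbergTorusWithField d L n J h with hHdef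
  have hH : H.IsHermitian := heisenbergTorusWithField_isHermitian d L n J h
  have hZ : partitionFn β H ≠ 0 := (partitionFn_pos β hH).ne'
  have hone : gibbsState β H 1 = 1 := gibbsState_one β H hZ
  have hcard : (Fintype.card (TorusSite d L) : ℂ) = (L : ℂ) ^ d := by
    rw [Fintype.card_fun, ZMod.card, Fintype.card_fin]
    push_cast
    rfl
  have hL0 : ((L : ℂ) ^ d) ≠ 0 := pow_ne_zero _ (Nat.cast_ne_zero.mpr hL.ne')
  have hinv_nonneg : (0 : ℂ) ≤ ((L : ℂ) ^ d)⁻¹ := by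
    have : ((L : ℂ) ^ d)⁻¹ = ((((L : ℝ) ^ d)⁻¹ : ℝ) : ℂ) := by push_cast; rfl
    rw [this]
    exact Complex.zero_le_real.mpr (by positivity)
  set A : Op (TorusSite d L) (n + 1) := ((L : ℂ) ^ d)⁻¹ • totalSpin n 2 with hAdef
  -- `S·1 - A ≥ 0` and `S·1 + A ≥ 0`
  have hsub : Matrix.PosSemidef (((n : ℂ) / 2) • (1 : Op (TorusSite d L) (n + 1)) - A) := by
    have h0 := (posSemidef_card_smul_one_sub_totalSpin (Λ := TorusSite d L) n 2).smul hinv_nonneg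
    rw [hcard, smul_sub, smul_smul, ← mul_assoc, inv_mul_cancel₀ hL0, one_mul] at h0
    exact h0
  have hadd : Matrix.PosSemidef (((n : ℂ) / 2) • (1 : Op (TorusSite d L) (n + 1)) + A) := by
    have h0 := (posSemidef_card_smul_one_add_totalSpin (Λ := TorusSite d L) n 2).smul hinv_nonneg
    rw [hcard, smul_add, smul_smul, ← mul_assoc, inv_mul_cancel₀ hL0, one_mul] at h0
    exact h0
  have hre : (((n : ℂ) / 2)).re = (n : ℝ) / 2 := by
    have : ((n : ℂ) / 2) = ((((n : ℝ) / 2) : ℝ) : ℂ) := by push_cast; rfl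
    rw [this, Complex.ofReal_re]
  -- upper bound
  have hup := gibbsState_nonneg_of_posSemidef β hH hsub
  rw [map_sub, LinearMap.map_smul, hone, smul_eq_mul, mul_one] at hup
  obtain ⟨hup_re, -⟩ := Complex.nonneg_iff.mp hup
  rw [Complex.sub_re, hre] at hup_re
  -- lower bound
  have hlo := gibbsState_nonneg_of_posSemidef β hH hadd
  rw [map_add, LinearMap.map_smul, hone, smul_eq_mul, mul_one] at hlo
  obtain ⟨hlo_re, -⟩ := Complex.nonneg_iff.mp hlo
  rw [Complex.add_re, hre] at hlo_re
  rw [abs_le]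
  constructor <;> linarith

/-! ### Discharge of `spinSpinCorrTorus_eq_gibbsState_spinDot` -/

section SpinDot

variable {d : ℕ}

/-- **Discharge of `spinSpinCorrTorus_eq_gibbsState_spinDot`**: the thermal correlation
`re Σ_α ⟨S^α_x S^α_y⟩_{β,L}` is the Gibbs expectation of the exchange operator
`𝐒_x · 𝐒_y = Σ_α ½ (S^α_x S^α_y + S^α_y S^α_x)` (`spinDot`). Proof: the Gibbs state is linear, and
for the Hermitian Hamiltonian `H_L` (`heisenbergHamiltonian_isHermitian`) and Hermitian spins
(`siteSpin_isHermitian`) one has `⟨S^α_y S^α_x⟩ = ⟨(S^α_x S^α_y)ᴴ⟩ = conj ⟨S^α_x S^α_y⟩`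
(`Matrix.gibbsState_conjTranspose`), so `re ½ (⟨S^α_x S^α_y⟩ + ⟨S^α_y S^α_x⟩) = re ⟨S^α_x S^α_y⟩`;
this is uniform in `x = y` / `x ≠ y` (no appeal to `siteSpin_commute_of_ne`). Tasaki (2020) §2.4,
eq. (2.4.1) (the exchange operator `𝐒_x · 𝐒_y` and its correlation `⟨𝐒_x · 𝐒_y⟩`); the Gibbs
state `tr(e^{-βH} ·)/Z` as in Bratteli–Robinson II §5.3.1, (5.3.2). [cite: Tasaki2020] -/
theorem spinSpinCorrTorus_eq_gibbsState_spinDot_holds :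
    spinSpinCorrTorus_eq_gibbsState_spinDot (d := d) := by
  intro β L _ n J x y
  have hH : (heisenbergTorus d L n J).IsHermitian := heisenbergHamiltonian_isHermitian n _ J
  rw [spinSpinCorrTorus_of_neZero]
  simp only [spinDot, spinBond, thermalCorr, map_sum, map_smul, map_add, smul_eq_mul,
    Complex.re_sum]
  refine Finset.sum_congr rfl fun α _ => ?_
  have key : gibbsState β (heisenbergTorus d L n J) (siteSpin n y α * siteSpin n x α) =
      star (gibbsState β (heisenbergTorus d L n J) (siteSpin n x α * siteSpin n y α)) := by
    rw [← gibbsState_conjTranspose β hH, conjTranspose_mul, (siteSpin_isHermitian n x α).eq,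
      (siteSpin_isHermitian n y α).eq]
  rw [key, Complex.star_def, Complex.add_conj]
  simp

end SpinDot

end Literature.MathematicalPhysics.QuantumLattice
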